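import Summits.Ventures.PercRepro.ProfileFlatUpsetHyperplane

/-!
# PercRepro — THE BOTTOM LEVEL OF (H-gen): AT `n − k = ρ(E)` THE MIRROR STATEMENT HOLDS FOR EVERY UP-SET (p10, gen 26;
unconditional)

For a finite matroid `M` on `n` elements of rank `ρ` and an up-set `U` of its flats, the bi-independent sets live at the
levels `n − ρ ≤ j ≤ ρ`; at the bottom level `k = n − ρ` the mirror level is `n − k = ρ`, where every bi-independent set is a
basis and spans `E` (`clF_eq_gr_of_rk_eq`), so `#{X ∈ BI_ρ : cl X ∈ U} = P_ρ·[E ∈ U]`; a non-empty up-set of flats contains `E`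
(`gr_mem_of_upFlats`), and `#{X ∈ BI_k : cl X ∈ U} ≤ P_k = P_ρ` (`card_biIndepSets_symm`).  Hence (H-gen) at the bottom level
(`card_filter_clF_mem_le_mirror_of_rk`) and, trivially, at every level `k` with `rk E < n − k` (`BI_k = ∅`,
`card_filter_clF_mem_le_mirror_of_rk_lt`).  Nothing here asserts (H-gen) or (H).
-/

open scoped Matroid

namespace PercRepro.Cogirth

open Finset ThmH Skew

variable {α : Type} [DecidableEq α] {M : Matroid α} [M.Finite]

omit [DecidableEq α] in
/-- The ground set is a flat. -/
theorem isFlatF_gr : IsFlatF M (gr M) :=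
  ⟨Subset.refl _, Subset.antisymm (clF_subset_gr_fu _) (subset_clF_fu (Subset.refl _))⟩

omit [DecidableEq α] in
/-- A non-empty up-set of flats contains the ground set. -/
theorem gr_mem_of_upFlats {U : Finset (Finset α)} (hU : UpFlats M U) {F : Finset α} (hF : F ∈ U) : gr M ∈ U :=
  hU.up F hF (gr M) isFlatF_gr (hU.flat F hF).1

/-- A bi-independent set of full rank spans the ground set, so at the level `j = rk E` the sets with closure in `U` are all
of `BI_j` when `E ∈ U` and none otherwise. -/
theorem filter_clF_mem_top {U : Finset (Finset α)} (hU : UpFlats M U) :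
    (biIndepSets M (rk M (gr M))).filter (fun X => clF M X ∈ U) =
      if gr M ∈ U then biIndepSets M (rk M (gr M)) else ∅ := by
  split_ifs with hE
  · apply filter_true_of_mem
    intro X hX
    rw [mem_biIndepSets] at hX
    obtain ⟨hXg, hXr, hXk, -⟩ := hX
    rw [clF_eq_gr_of_rk_eq hXg (by rw [hXk, hXr])]
    exact hE
  · rw [filter_eq_empty_iff]
    intro X hX hcl
    exact hE (gr_mem_of_upFlats hU hcl)

/-- **(H-gen) AT THE BOTTOM LEVEL** `n − k = rk E` (unconditional): `#{X ∈ BI_k : cl X ∈ U} ≤ #{X ∈ BI_{n−k} : cl X ∈ U}` for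
every up-set `U` of flats and `2k < n`. -/
theorem card_filter_clF_mem_le_mirror_of_rk {k : ℕ} (hk : 2 * k < (gr M).card)
    (hρ : (gr M).card - k = rk M (gr M)) {U : Finset (Finset α)} (hU : UpFlats M U) :
    ((biIndepSets M k).filter (fun X => clF M X ∈ U)).card ≤
      ((biIndepSets M ((gr M).card - k)).filter (fun X => clF M X ∈ U)).card := by
  rw [hρ, filter_clF_mem_top hU]
  split_ifs with hE
  · calc ((biIndepSets M k).filter (fun X => clF M X ∈ U)).card ≤ (biIndepSets M k).card := card_filter_le _ _
      _ = (biIndepSets M ((gr M).card - k)).card := card_biIndepSets_symm M (by omega)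
      _ = (biIndepSets M (rk M (gr M))).card := by rw [hρ]
  · rw [card_empty, Nat.le_zero, card_eq_zero, filter_eq_empty_iff]
    intro X _ hcl
    exact hE (gr_mem_of_upFlats hU hcl)

/-- Above the rank no set is bi-independent: (H-gen) holds at every level `k` with `rk E < n − k` (both sides vanish when
`U` is non-empty, and the left side always). -/
theorem card_filter_clF_mem_le_mirror_of_rk_lt {k : ℕ}
    (hρ : rk M (gr M) < (gr M).card - k) (U : Finset (Finset α)) :
    ((biIndepSets M k).filter (fun X => clF M X ∈ U)).card ≤
      ((biIndepSets M ((gr M).card - k)).filter (fun X => clF M X ∈ U)).card := by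
  have h0 : biIndepSets M k = ∅ := biIndepSets_eq_empty_of_lt (by omega)
  rw [h0, filter_empty, card_empty]
  exact Nat.zero_le _

end PercRepro.Cogirth
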